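/-
Copyright: the H21 programme. Soloist `solo-ValiantsHypothesis-informed`, session 9.

The Boolean sibling (Q^𝔹*) of session 7 is FALSE as stated; the private-points repair.
-/
import Mathlib
import Summits.ValiantsHypothesis.ValiantsHypothesis.Theorems.SoloInformedBooleanQuadSpan
import Summits.ValiantsHypothesis.ValiantsHypothesis.Theorems.SoloInformedRSDesign

/-!
# The Boolean bound structure `SoloBoolQuadSpanBound` has `Q (2t) ≥ t²`; the private-points repair

`SoloInformedBooleanQuadSpan.lean` reduced `VP ℂ ≠ VNP ℂ` to the existence of a bound structure
`B : SoloBoolQuadSpanBound K h` with `B.Q s ≤ C·s^γ` for some `γ < 3/2` ("conjecture (Q^𝔹*)").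
This file shows that NO such structure exists, for any `K`, `h` and any `γ < 2`:

* `soloInformed_boolQuadSpanBound_ge` — for every `B : SoloBoolQuadSpanBound K h` and every `t`,
  `t * t ≤ B.Q (t + t)`;
* `soloInformed_boolQuadSpanStar_false` — hence `C·s^γ < B.Q s` for some `s ≥ 1` whenever `γ < 2`
  (the trivial structure `soloInformed_boolQuadSpanBound_trivial` has `Q s = (s+2 choose 2)`, so the
  exponent `2` is attained).

**The witness (augmented grid).** Ground set: the `t × t` grid cells together with one private point
`a_i` per row and one private point `b_j` per column (`n = t*t + (t+t)` coordinates). Put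
`A_i = row_i ∪ {a_i}`, `B_j = col_j ∪ {b_j}` and take the `t*t` targets `S_{ij} = A_i Δ B_j`.
On the cube `{±1}ⁿ` the parity of a symmetric difference is the product of the parities
(`soloParity_mul`), so with the `s = t + t` sections `v = (χ_{A_1},…,χ_{A_t},χ_{B_1},…,χ_{B_t})` every
target is `Γ_{ij}(v) = X_i · X_{t+j}`, of total degree `2`.  Yet the family `(S_{ij})` is
sign-independent to ALL orders and heights: if `∑ c_{ij} 1_{S_{ij}} = 0` then evaluating at `a_p`
gives the row sum `R_p = 0`, at `b_q` the column sum `C_q = 0`, and at the cell `(p,q)` the value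
`R_p + C_q − 2 c_{pq} = 0`, so `c = 0`.  (Sign-independence is a condition on the `ℤ`-span of the
`0/1`-vectors `1_S`, while parities multiply along symmetric difference, `1_{AΔB} = 1_A + 1_B − 2·1_{A∩B}`;
the factor `2` is invisible to sign-independence but not to the group law of the cube.  The earlier
heuristic "Boolean baseline = univariate baseline" had only examined DISJOINT `A_j`.)

**The repair.** The designs the reduction actually uses (Reed–Solomon / polynomial-evaluation families,
`SoloInformedRSDesign.lean`) have PRIVATE POINTS to order `K` (every `i ∈ T`, `|T| ≤ K`, owns a point of
`S_i` outside `⋃_{j ∈ T, j ≠ i} S_j`), a property the grid family lacks as soon as `t ≥ 2`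
(`solo_augGrid_no_privatePoints`: a `2 × 2` rectangle of targets covers each of its members).  The
structure `SoloBoolQuadSpanBoundPP K` quantifies the Boolean bound over private-point families only, and
`soloInformed_vp_ne_vnp_of_boolQuadSpanBoundPP_cor58` is the corresponding reduction of `VP ℂ ≠ VNP ℂ`
(Raz, Cor. 5.8), with the same growth hypotheses as before and the private-point families supplied
unconditionally by `soloInformed_nonempty_ppFamily`.  Whether a private-point bound structure with
`Q s = O(s^γ)`, `γ < 3/2`, exists — conjecture (Q^𝔹ₚₚ*) — is open; for sections that are themselves
parities it holds at the univariate baseline `O(s^{1+1/⌊K/2⌋})` (a cycle of length `≤ K` among products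
`χ_A χ_B` destroys private points), so a counterexample needs genuinely non-character sections.

[folklore] for the combinatorics; [cite: Raz2010, Cor. 5.8] for the reduction it feeds.
-/

noncomputable section

open MvPolynomial Finset

namespace Summit.ValiantsHypothesis.ValiantsHypothesis.Theorems

open Literature.Computability.AlgebraicComplexity

/-! ### The augmented grid family -/

section AugGrid

variable (t : ℕ)

/-- Points of the augmented grid: cells `(p,q)`, then row-points `a_p`, then column-points `b_q`. -/
abbrev SoloAugPt : Type := (Fin t × Fin t) ⊕ (Fin t ⊕ Fin t)

/-- Number of coordinates of the augmented grid. -/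
abbrev soloAugN : ℕ := t * t + (t + t)

/-- Decoding a coordinate `r : Fin (t*t + (t+t))` into a cell / row-point / column-point. -/
def soloAugDecode : Fin (soloAugN t) ≃ SoloAugPt t :=
  finSumFinEquiv.symm.trans (Equiv.sumCongr finProdFinEquiv.symm finSumFinEquiv.symm)

/-- Decoding a target index `i : Fin (t*t)` into its (row, column). -/
def soloTgt : Fin (t * t) ≃ Fin t × Fin t := finProdFinEquiv.symm

open Classical in
/-- `A_i = row_i ∪ {a_i}` as a set of coordinates: the cells `(i, q)` and the row-point `a_i`. -/
def soloRowSet (i : Fin t) : Finset (Fin (soloAugN t)) :=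
  univ.filter fun r =>
    Sum.elim (fun pq => pq.1 = i) (Sum.elim (fun p => p = i) fun _ => False) (soloAugDecode t r)

open Classical in
/-- `B_j = col_j ∪ {b_j}` as a set of coordinates: the cells `(p, j)` and the column-point `b_j`. -/
def soloColSet (j : Fin t) : Finset (Fin (soloAugN t)) :=
  univ.filter fun r =>
    Sum.elim (fun pq => pq.2 = j) (Sum.elim (fun _ => False) fun q => q = j) (soloAugDecode t r)

/-- The targets `S_{ij} = A_i Δ B_j`. -/
def soloAugSet (ij : Fin t × Fin t) : Finset (Fin (soloAugN t)) :=
  soloRowSet t ij.1 \ soloColSet t ij.2 ∪ soloColSet t ij.2 \ soloRowSet t ij.1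

variable {t}

/-- Membership of a decoded point in `A_i`. -/
@[simp] theorem solo_mem_rowSet (i : Fin t) (w : SoloAugPt t) :
    (soloAugDecode t).symm w ∈ soloRowSet t i ↔
      Sum.elim (fun pq => pq.1 = i) (Sum.elim (fun p => p = i) fun _ => False) w := by
  simp [soloRowSet]

/-- Membership of a decoded point in `B_j`. -/
@[simp] theorem solo_mem_colSet (j : Fin t) (w : SoloAugPt t) :
    (soloAugDecode t).symm w ∈ soloColSet t j ↔
      Sum.elim (fun pq => pq.2 = j) (Sum.elim (fun _ => False) fun q => q = j) w := by
  simp [soloColSet]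

/-- The row-point `a_p` lies in `S_{ij}` iff `i = p`. -/
theorem solo_mem_augSet_rowpt (ij : Fin t × Fin t) (p : Fin t) :
    (soloAugDecode t).symm (Sum.inr (Sum.inl p)) ∈ soloAugSet t ij ↔ p = ij.1 := by
  simp [soloAugSet]

/-- The column-point `b_q` lies in `S_{ij}` iff `j = q`. -/
theorem solo_mem_augSet_colpt (ij : Fin t × Fin t) (q : Fin t) :
    (soloAugDecode t).symm (Sum.inr (Sum.inr q)) ∈ soloAugSet t ij ↔ q = ij.2 := by
  simp [soloAugSet]

/-- The cell `(p,q)` lies in `S_{ij}` iff exactly one of `p = i`, `q = j` holds. -/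
theorem solo_mem_augSet_cell (ij : Fin t × Fin t) (p q : Fin t) :
    (soloAugDecode t).symm (Sum.inl (p, q)) ∈ soloAugSet t ij ↔
      (p = ij.1 ∧ ¬ q = ij.2) ∨ (q = ij.2 ∧ ¬ p = ij.1) := by
  simp [soloAugSet]

/-- **Sign-independence of the augmented grid to all orders and heights.** -/
theorem solo_augGrid_indep (c : Fin (t * t) → ℤ)
    (hsum : ∀ r : Fin (soloAugN t),
      (∑ i : Fin (t * t), if r ∈ soloAugSet t (soloTgt t i) then c i else 0) = 0) :
    ∀ i, c i = 0 := by
  classical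
  intro i₀
  obtain ⟨p, q, hpq⟩ : ∃ p q : Fin t, soloTgt t i₀ = (p, q) := ⟨_, _, rfl⟩
  have hrow := hsum ((soloAugDecode t).symm (Sum.inr (Sum.inl p)))
  have hcol := hsum ((soloAugDecode t).symm (Sum.inr (Sum.inr q)))
  have hcell := hsum ((soloAugDecode t).symm (Sum.inl (p, q)))
  simp only [solo_mem_augSet_rowpt] at hrow
  simp only [solo_mem_augSet_colpt] at hcol
  simp only [solo_mem_augSet_cell] at hcell
  have hi : ∀ i, (i₀ = i) ↔ (p = (soloTgt t i).1 ∧ q = (soloTgt t i).2) := by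
    intro i
    rw [← (soloTgt t).injective.eq_iff, hpq, Prod.ext_iff]
  have hx : ∀ i : Fin (t * t),
      (if (p = (soloTgt t i).1 ∧ ¬ q = (soloTgt t i).2) ∨ (q = (soloTgt t i).2 ∧ ¬ p = (soloTgt t i).1)
        then c i else 0)
        = (if p = (soloTgt t i).1 then c i else 0) +
          ((if q = (soloTgt t i).2 then c i else 0) - 2 * (if i₀ = i then c i else 0)) := by
    intro i
    by_cases h1 : p = (soloTgt t i).1 <;> by_cases h2 : q = (soloTgt t i).2 <;>
      simp [h1, h2, hi]
    ring
  have hsplit : (∑ i : Fin (t * t),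
      (if (p = (soloTgt t i).1 ∧ ¬ q = (soloTgt t i).2) ∨ (q = (soloTgt t i).2 ∧ ¬ p = (soloTgt t i).1)
        then c i else 0))
      = (∑ i : Fin (t * t), if p = (soloTgt t i).1 then c i else 0) +
        ((∑ i : Fin (t * t), if q = (soloTgt t i).2 then c i else 0) -
          2 * ∑ i : Fin (t * t), if i₀ = i then c i else 0) := by
    rw [Finset.mul_sum, ← Finset.sum_sub_distrib, ← Finset.sum_add_distrib]
    exact Finset.sum_congr rfl fun i _ => hx i
  rw [hsplit, hrow, hcol, Finset.sum_ite_eq, if_pos (Finset.mem_univ _)] at hcell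
  linarith

/-- **No private points.** For `t ≥ 2` the augmented grid family has no private points already to
order `4`: the rectangle `{S₀₀, S₀₁, S₁₀, S₁₁}` covers each of its members by the other three. -/
theorem solo_augGrid_no_privatePoints (ht : 2 ≤ t) :
    ¬ ∀ T : Finset (Fin (t * t)), T.card ≤ 4 → ∀ i ∈ T, ∃ x ∈ soloAugSet t (soloTgt t i),
        ∀ j ∈ T, j ≠ i → x ∉ soloAugSet t (soloTgt t j) := by
  classical
  intro hpp
  have h0 : 0 < t := by omega
  have h1 : 1 < t := by omega
  set z : Fin t := ⟨0, h0⟩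
  set o : Fin t := ⟨1, h1⟩
  have hzo : z ≠ o := by simp [z, o, Fin.ext_iff]
  let ι : Fin t × Fin t → Fin (t * t) := (soloTgt t).symm
  let T : Finset (Fin (t * t)) := {ι (z, z), ι (z, o), ι (o, z), ι (o, o)}
  have hT : T.card ≤ 4 := by
    refine (Finset.card_insert_le _ _).trans ?_
    refine Nat.succ_le_succ ((Finset.card_insert_le _ _).trans ?_)
    refine Nat.succ_le_succ ((Finset.card_insert_le _ _).trans ?_)
    simp
  have hinj : Function.Injective ι := (soloTgt t).symm.injective
  obtain ⟨x, hx, hpriv⟩ := hpp T hT (ι (z, z)) (by simp [T])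
  have hmem : ∀ ab : Fin t × Fin t, ι ab ∈ T → ab ≠ (z, z) → x ∉ soloAugSet t ab := by
    intro ab hab hne
    have := hpriv (ι ab) hab (fun h => hne (hinj h))
    simpa [ι, soloTgt] using this
  have hx' : x ∈ soloAugSet t (z, z) := by simpa [ι, soloTgt] using hx
  -- decode `x`
  obtain ⟨w, rfl⟩ : ∃ w, x = (soloAugDecode t).symm w := ⟨soloAugDecode t x, by simp⟩
  have m01 := hmem (z, o) (by simp [T]) (by simp [hzo.symm])
  have m10 := hmem (o, z) (by simp [T]) (by simp [hzo.symm])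
  have m11 := hmem (o, o) (by simp [T]) (by simp [hzo.symm])
  rcases w with ⟨p, q⟩ | p | q
  · rw [solo_mem_augSet_cell] at hx' m01 m10 m11
    simp only at hx' m01 m10 m11
    by_cases hp : p = o <;> by_cases hq : q = o <;> simp_all
  · rw [solo_mem_augSet_rowpt] at hx' m01
    exact m01 hx'
  · rw [solo_mem_augSet_colpt] at hx' m10
    exact m10 hx'

/-- The augmented grid family as a `(K,h)`-design, for every `K` and `h`. -/
def soloAugDesign (K h t : ℕ) : SoloDesign K h (t * t) (soloAugN t) where
  S := fun i => soloAugSet t (soloTgt t i)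
  indep := fun c _ _ hsum => solo_augGrid_indep c hsum

/-- The sections: the `t` row parities `χ_{A_i}` followed by the `t` column parities `χ_{B_j}`. -/
def soloAugV (x : Fin (soloAugN t) → Bool) (k : Fin (t + t)) : ℂ :=
  Sum.elim (fun i => soloParity (soloRowSet t i) x) (fun j => soloParity (soloColSet t j) x)
    (finSumFinEquiv.symm k)

/-- The degree-`2` map realising the targets: `Γ_{ij} = X_i · X_{t+j}`. -/
def soloAugΓ (ij : Fin t × Fin t) : MvPolynomial (Fin (t + t)) ℂ :=
  X (finSumFinEquiv (Sum.inl ij.1)) * X (finSumFinEquiv (Sum.inr ij.2))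

/-- `Γ_{ij}` has total degree `≤ 2`. -/
theorem soloAugΓ_totalDegree (ij : Fin t × Fin t) : (soloAugΓ (t := t) ij).totalDegree ≤ 2 :=
  calc (soloAugΓ (t := t) ij).totalDegree
      ≤ (X (finSumFinEquiv (Sum.inl ij.1)) : MvPolynomial (Fin (t + t)) ℂ).totalDegree +
          (X (finSumFinEquiv (Sum.inr ij.2)) : MvPolynomial (Fin (t + t)) ℂ).totalDegree :=
        totalDegree_mul _ _
    _ = 2 := by simp [totalDegree_X]

/-- `Γ_{ij}(v(x)) = χ_{A_i}(x) χ_{B_j}(x) = χ_{S_{ij}}(x)` on the cube. -/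
theorem soloAugΓ_eval (ij : Fin t × Fin t) (x : Fin (soloAugN t) → Bool) :
    eval (soloAugV x) (soloAugΓ ij) = soloParity (soloAugSet t ij) x := by
  simp only [soloAugΓ, soloAugV, map_mul, eval_X, Equiv.symm_apply_apply, Sum.elim_inl,
    Sum.elim_inr, soloAugSet, soloParity_mul]

end AugGrid

/-! ### (Q^𝔹*) is false -/

/-- **Main counterexample.** Every Boolean bound structure has `Q (2t) ≥ t²`. -/
theorem soloInformed_boolQuadSpanBound_ge {K h : ℕ} (B : SoloBoolQuadSpanBound K h) (t : ℕ) :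
    t * t ≤ B.Q (t + t) :=
  B.bound (soloAugN t) (t * t) (t + t) (soloAugDesign K h t) soloAugV fun i =>
    ⟨soloAugΓ (soloTgt t i), soloAugΓ_totalDegree _, fun x => soloAugΓ_eval _ x⟩

/-- **(Q^𝔹\*) is false**: for no `K`, `h` is there a Boolean bound structure with `Q s = O(s^γ)`,
`γ < 2` — in particular none with `γ < 3/2`, the hypothesis of
`soloInformed_vp_ne_vnp_of_boolQuadSpanBound_cor58`. -/
theorem soloInformed_boolQuadSpanStar_false {K h : ℕ} (B : SoloBoolQuadSpanBound K h)
    (C γ : ℝ) (hγ : γ < 2) : ∃ s : ℕ, 1 ≤ s ∧ C * (s : ℝ) ^ γ < (B.Q s : ℝ) := by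
  by_cases hC : C ≤ 0
  · refine ⟨1 + 1, by norm_num, ?_⟩
    have h1 := soloInformed_boolQuadSpanBound_ge B 1
    have hpos : (0 : ℝ) < ((1 + 1 : ℕ) : ℝ) ^ γ := Real.rpow_pos_of_pos (by norm_num) γ
    have hle : C * ((1 + 1 : ℕ) : ℝ) ^ γ ≤ 0 := by nlinarith
    have hQ : (1 : ℝ) ≤ (B.Q (1 + 1) : ℝ) := by exact_mod_cast h1
    linarith
  · push Not at hC
    have hε : 0 < 2 - γ := by linarith
    have hM : 0 < C * (2 : ℝ) ^ γ := mul_pos hC (Real.rpow_pos_of_pos two_pos γ)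
    obtain ⟨t, ht1, htε⟩ : ∃ t : ℕ, 1 ≤ t ∧ C * (2 : ℝ) ^ γ < (t : ℝ) ^ (2 - γ) := by
      have hlim : Filter.Tendsto (fun t : ℕ => ((t : ℝ)) ^ (2 - γ)) Filter.atTop Filter.atTop :=
        (tendsto_rpow_atTop hε).comp tendsto_natCast_atTop_atTop
      obtain ⟨t, ht⟩ :=
        ((hlim.eventually_gt_atTop (C * (2 : ℝ) ^ γ)).and (Filter.eventually_ge_atTop 1)).exists
      exact ⟨t, ht.2, ht.1⟩
    refine ⟨t + t, by omega, ?_⟩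
    have hQ := soloInformed_boolQuadSpanBound_ge B t
    have htpos : (0 : ℝ) < t := by exact_mod_cast ht1
    have htγ : 0 < (t : ℝ) ^ γ := Real.rpow_pos_of_pos htpos γ
    have h2t : ((t + t : ℕ) : ℝ) = 2 * t := by push_cast; ring
    have ht2 : (t : ℝ) * t = (t : ℝ) ^ γ * (t : ℝ) ^ (2 - γ) := by
      rw [← Real.rpow_add htpos, show γ + (2 - γ) = (2 : ℝ) by ring, Real.rpow_two, sq]
    have key : C * ((t + t : ℕ) : ℝ) ^ γ < (t : ℝ) * t := by
      rw [h2t, Real.mul_rpow (by norm_num) htpos.le, ht2]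
      calc C * ((2 : ℝ) ^ γ * (t : ℝ) ^ γ) = (C * (2 : ℝ) ^ γ) * (t : ℝ) ^ γ := by ring
        _ < (t : ℝ) ^ (2 - γ) * (t : ℝ) ^ γ := mul_lt_mul_of_pos_right htε htγ
        _ = (t : ℝ) ^ γ * (t : ℝ) ^ (2 - γ) := mul_comm _ _
    calc C * ((t + t : ℕ) : ℝ) ^ γ < (t : ℝ) * t := key
      _ = ((t * t : ℕ) : ℝ) := by push_cast; ring
      _ ≤ (B.Q (t + t) : ℝ) := by exact_mod_cast hQ

/-! ### The repair: private-point families -/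

/-- A **private-point family** of order `K`: `m` subsets of `Fin n` such that in every subfamily of
at most `K` members each member owns a coordinate outside the others (`(K-1)`-cover-freeness).
Such a family is a `(K,h)`-design for every `h` (`SoloDesign.ofPrivatePoints`). -/
structure SoloPPFamily (K m n : ℕ) where
  /-- the supports -/
  S : Fin m → Finset (Fin n)
  /-- private points to order `K` -/
  pp : ∀ T : Finset (Fin m), T.card ≤ K → ∀ i ∈ T, ∃ x ∈ S i, ∀ j ∈ T, j ≠ i → x ∉ S j

/-- A private-point family is a design of every height. -/
def SoloPPFamily.toDesign {K m n : ℕ} (h : ℕ) (F : SoloPPFamily K m n) : SoloDesign K h m n :=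
  SoloDesign.ofPrivatePoints F.S F.pp

/-- The augmented grid family is NOT a private-point family of any order `K ≥ 4` (`t ≥ 2`). -/
theorem solo_augGrid_not_ppFamily {t K : ℕ} (ht : 2 ≤ t) (hK : 4 ≤ K)
    (F : SoloPPFamily K (t * t) (soloAugN t)) : F.S ≠ fun i => soloAugSet t (soloTgt t i) := by
  intro hF
  refine solo_augGrid_no_privatePoints ht fun T hT => ?_
  have h := F.pp T (hT.trans hK)
  rw [hF] at h
  exact h

/-- **Repaired Boolean bound structure (Q^𝔹ₚₚ).** `Q` bounds the number of members of any
private-point family (order `K`) whose parities are realised on the whole cube by a total-degree-`2`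
polynomial map in `s` variables composed with arbitrary sections. -/
structure SoloBoolQuadSpanBoundPP (K : ℕ) where
  /-- the bound, as a function of the number `s` of sections -/
  Q : ℕ → ℕ
  /-- the bound holds for private-point families -/
  bound : ∀ (n m s : ℕ) (F : SoloPPFamily K m n) (v : (Fin n → Bool) → Fin s → ℂ),
    (∀ i : Fin m, ∃ Γ : MvPolynomial (Fin s) ℂ, Γ.totalDegree ≤ 2 ∧
        ∀ x : Fin n → Bool, eval (v x) Γ = soloParity (F.S i) x) →
      m ≤ Q s

/-- Forgetting the private-point hypothesis: every (refuted-shape) `SoloBoolQuadSpanBound K 1`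
would give a `SoloBoolQuadSpanBoundPP K` — recorded only to make the comparison precise. -/
def SoloBoolQuadSpanBound.toPP {K : ℕ} (B : SoloBoolQuadSpanBound K 1) :
    SoloBoolQuadSpanBoundPP K where
  Q := B.Q
  bound := fun n m s F v hv => B.bound n m s (F.toDesign 1) v hv

/-- **Elusiveness from a private-point Boolean bound.** -/
theorem soloInformed_isElusive_designMap_of_boolPP {K m n : ℕ} (F : SoloPPFamily K m n)
    (B : SoloBoolQuadSpanBoundPP K) {s : ℕ} (hm : B.Q s < m) :
    IsElusive (soloDesignMap F.S) s 2 := by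
  by_contra hne
  obtain ⟨Γ, hΓ, v, hv⟩ := solo_restrict_of_not_isElusive hne (soloCubePoint (n := n))
  have hb := B.bound n m s F v fun i =>
    ⟨Γ i, hΓ i, fun x => by rw [hv x i, solo_eval_designMap_cube]⟩
  omega

/-- Private-point families with the Reed–Solomon parameters exist (from `SoloInformedRSDesign`):
`m ≤ q^k` members on `n ≥ q²` coordinates, of every order `K` with `(K-1)(k-1) < q`, `q` prime. -/
theorem soloInformed_nonempty_ppFamily (K k q m n : ℕ) (hq : q.Prime)
    (hKq : (K - 1) * (k - 1) < q) (hm : m ≤ q ^ k) (hn : q * q ≤ n) :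
    Nonempty (SoloPPFamily K m n) := by
  classical
  haveI : Fact q.Prime := ⟨hq⟩
  have hcardι : Fintype.card (Fin k → ZMod q) = q ^ k := by
    simp [ZMod.card]
  have hcardg : Fintype.card (ZMod q × ZMod q) = q * q := by
    simp [Fintype.card_prod, ZMod.card]
  let eι : Fin m ↪ (Fin k → ZMod q) :=
    (Fin.castLEEmb hm).trans (Fintype.equivFinOfCardEq hcardι).symm.toEmbedding
  let eg : ZMod q × ZMod q ↪ Fin n :=
    (Fintype.equivFinOfCardEq hcardg).toEmbedding.trans (Fin.castLEEmb hn)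
  exact ⟨⟨fun i => (soloRSSet (eι i)).map eg,
    solo_pp_transfer soloRSSet eι eg (solo_rs_privatePoints q k K hKq)⟩⟩

/-- **`VP ≠ VNP` from a private-point Boolean bound (Raz, Cor. 5.8).** The repaired form of
`soloInformed_vp_ne_vnp_of_boolQuadSpanBound_cor58`: the designs are replaced by private-point
families `F n` (which exist with the required parameters by `soloInformed_nonempty_ppFamily`),
and the bound structure by `SoloBoolQuadSpanBoundPP K`. [cite: Raz2010, Cor. 5.8] -/
theorem soloInformed_vp_ne_vnp_of_boolQuadSpanBoundPP_cor58 {K : ℕ} (B : SoloBoolQuadSpanBoundPP K)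
    {r s : ℕ → ℕ} (F : ∀ n, SoloPPFamily K (Nat.choose (n + r n - 1) (r n)) n)
    (hpar : ∃ n₀, ∀ n ≥ n₀, 3 ≤ r n ∧ r n ≤ n ∧ n ≤ s n)
    (hgrow : ∀ c : ℕ, ∃ n₀, ∀ n ≥ n₀, n ^ c * Nat.choose (n + 2 * r n / 3 - 1) (2 * r n / 3) ≤ s n)
    (hQm : ∃ n₀, ∀ n ≥ n₀, B.Q (s n) < Nat.choose (n + r n - 1) (r n))
    (hdef : IsPolyDefinableMap (m := fun n => Nat.choose (n + r n - 1) (r n))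
      (σ := fun n => Fin n) fun n => soloDesignMap (F n).S) :
    VP ℂ ≠ VNP ℂ := by
  refine perNotPComputableComplex_iff_holds.mp ?_
  have hel : ∃ n₀ : ℕ, ∀ n ≥ n₀, ∃ (G : Type) (_ : Field G) (_ : Algebra ℂ G),
      IsElusive (fun i => MvPolynomial.map (algebraMap ℂ G) (soloDesignMap (F n).S i))
        (s n) 2 := by
    obtain ⟨n₀, h0⟩ := hQm
    refine ⟨n₀, fun n hn => ⟨ℂ, inferInstance, inferInstance, ?_⟩⟩
    have hid : (fun i => MvPolynomial.map (algebraMap ℂ ℂ) (soloDesignMap (F n).S i))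
        = soloDesignMap (F n).S := by
      funext i
      rw [Algebra.algebraMap_self, MvPolynomial.map_id]
    rw [hid]
    exact soloInformed_isElusive_designMap_of_boolPP (F n) B (h0 n hn)
  exact Raz2010_cor_5_8_holds ℂ ringChar_complex_ne_two r s (fun n => soloDesignMap (F n).S)
    hpar hgrow hdef hel

end Summit.ValiantsHypothesis.ValiantsHypothesis.Theorems
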